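import Mathlib
import HarnessLib
import Summits.MatrixMultiplication.MatrixMultiplication.Theorems.FarEdgeDescentSlabAffine
import Summits.MatrixMultiplication.MatrixMultiplication.Theorems.FarEdgeDescentCert19P12
import Summits.MatrixMultiplication.MatrixMultiplication.Theorems.FarEdgeDescentCert85P28
import Summits.MatrixMultiplication.MatrixMultiplication.Theorems.FarEdgeDescentCert3920P11
import Summits.MatrixMultiplication.MatrixMultiplication.Theorems.FarEdgeDescentCert199P12

/-!
# Far-edge descent — every arity `a ≥ 2` (model level)

The floor fractions `τ'ⱼ(a, β) = min 1 (β/(2 − a^{-j}))` are antitone in the arity parameter `a`, so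
`Vfloor 2 β z m ≤ Vfloor a β z m` for `a ≥ 2` (`Vfloor_mono_a`): a certificate of the region criterion with a floor
level `Vmin' ≤ Vfloor 2 β z m` caps XL-D for EVERY dial `(a, β)` with `a ≥ 2`, not only `a = 2`
(`capXLD_allA_of_criterion`, `capXLD_allA_of_slab`, `capXLD_allA_of_slabA`).  Corollaries for the certified dials
β = 8/5, 19/10, 39/20, 199/100: `capXLD_allA_eight_fifths`, `…_nineteen_tenths`, `…_39_20`, `…_199_100`.
No `sorry`.
-/

noncomputable section

set_option linter.dupNamespace false
set_option linter.style.longLine false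

namespace Summit.MatrixMultiplication.MatrixMultiplication.Theorems.FarEdgeDescentAllArities

open Finset
open Summit.MatrixMultiplication.MatrixMultiplication.Theorems.FarEdgeDescentFloorDial
open Summit.MatrixMultiplication.MatrixMultiplication.Theorems.FarEdgeDescentFloorDial.Sched
open Summit.MatrixMultiplication.MatrixMultiplication.Theorems.FarEdgeDescentNarrownessPotential
open Summit.MatrixMultiplication.MatrixMultiplication.Theorems.FarEdgeDescentFloorNarrowness
open Summit.MatrixMultiplication.MatrixMultiplication.Theorems.FarEdgeDescentCriterionCells
open Summit.MatrixMultiplication.MatrixMultiplication.Theorems.FarEdgeDescentSlabTools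
open Summit.MatrixMultiplication.MatrixMultiplication.Theorems.FarEdgeDescentSlabFloor
open Summit.MatrixMultiplication.MatrixMultiplication.Theorems.FarEdgeDescentSlabAffine

/-- `τ'ⱼ` is antitone in the arity parameter: `tauP a β j ≤ tauP 2 β j` for `a ≥ 2`, `β ≥ 0`. -/
theorem tauP_anti_a {a β : ℝ} (ha : 2 ≤ a) (hβ : 0 ≤ β) (j : ℕ) : tauP a β j ≤ tauP 2 β j := by
  unfold tauP
  have h2 : (0:ℝ) < 2 := by norm_num
  have hinv : a⁻¹ ≤ (2:ℝ)⁻¹ := by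
    rw [inv_le_inv₀ (by linarith) h2]; exact ha
  have hpow : a⁻¹ ^ j ≤ (2:ℝ)⁻¹ ^ j := pow_le_pow_left₀ (inv_nonneg.mpr (by linarith)) hinv j
  have hd2 : 1 ≤ 2 - (2:ℝ)⁻¹ ^ j := floorDen_ge_one le_rfl j
  exact min_le_min le_rfl (div_le_div_of_nonneg_left hβ (by linarith) (by linarith))

/-- **`Vfloor` is monotone in the arity parameter:** `Vfloor 2 β z m ≤ Vfloor a β z m` (`a ≥ 2`, `β ≥ 0`, `0 ≤ z ≤ 1`). -/
theorem Vfloor_mono_a {a β z : ℝ} (ha : 2 ≤ a) (hβ : 0 ≤ β) (hz0 : 0 ≤ z) (hz1 : z ≤ 1) (m : ℕ) :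
    Vfloor 2 β z m ≤ Vfloor a β z m := by
  unfold Vfloor
  have hs : ∑ k ∈ range m, tauP a β (k + 2) * z ^ k ≤ ∑ k ∈ range m, tauP 2 β (k + 2) * z ^ k :=
    sum_le_sum fun k _ => mul_le_mul_of_nonneg_right (tauP_anti_a ha hβ (k + 2)) (pow_nonneg hz0 k)
  have ht : tauP a β (m + 2) * z ^ m ≤ tauP 2 β (m + 2) * z ^ m :=
    mul_le_mul_of_nonneg_right (tauP_anti_a ha hβ (m + 2)) (pow_nonneg hz0 m)
  have h1z : 0 ≤ 1 - z := by linarith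
  have hm := mul_le_mul_of_nonneg_left hs h1z
  linarith

/-- **XL-D for every arity from one criterion at the `a = 2` floor level.** -/
theorem capXLD_allA_of_criterion {a β z ε Vmin' : ℝ} (m : ℕ) (ha : 2 ≤ a) (hβ : 3 / 2 ≤ β) (hβ2 : β ≤ 2)
    (hz : 9 / 10 ≤ z) (hz1 : z ≤ 1) (hε : 0 < ε) (hle : Vmin' ≤ Vfloor 2 β z m)
    (hcrit : RegionCriterion β z ε Vmin' (Real.log (4 / 3) / Real.log 2)) :
    ∀ R : ℝ, 0 ≤ R → ∀ y₀ : ℝ → ℝ, (∀ b : ℝ, 0 ≤ b → 0 ≤ y₀ b ∧ y₀ b ≤ R / (b + β)) →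
      ∃ C : ℝ, ∀ s : Sched, Admissible a β s →
        dev β y₀ s ≤ C * logSize β s ^ (Real.log (4 / 3) / Real.log 2) :=
  capXLD_of_regionCriterion_le m ha hβ hβ2 hz hz1 hε
    (hle.trans (Vfloor_mono_a ha (by linarith) (by linarith) hz1 m)) hcrit

/-- Every arity, constant-floor slab form: a criterion for every β of `[β₀, β₁]` at a level below the `a = 2` floor
at `β₁` caps XL-D(a, β) for all `a ≥ 2` and all β of the slab. -/
theorem capXLD_allA_of_slab {β₀ β₁ z ε Vmin' : ℝ} (m : ℕ) (hβ₀ : 3 / 2 ≤ β₀) (hβ₁ : β₁ ≤ 2)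
    (hz : 9 / 10 ≤ z) (hz1 : z ≤ 1) (hε : 0 < ε) (hle : Vmin' ≤ Vfloor 2 β₁ z m)
    (hcrit : ∀ β : ℝ, β₀ ≤ β → β ≤ β₁ → RegionCriterion β z ε Vmin' (Real.log (4 / 3) / Real.log 2)) :
    ∀ a β : ℝ, 2 ≤ a → β₀ ≤ β → β ≤ β₁ →
      ∀ R : ℝ, 0 ≤ R → ∀ y₀ : ℝ → ℝ, (∀ b : ℝ, 0 ≤ b → 0 ≤ y₀ b ∧ y₀ b ≤ R / (b + β)) →
        ∃ C : ℝ, ∀ s : Sched, Admissible a β s →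
          dev β y₀ s ≤ C * logSize β s ^ (Real.log (4 / 3) / Real.log 2) :=
  fun _ β ha h0 h1 => capXLD_allA_of_criterion m ha (hβ₀.trans h0) (h1.trans hβ₁) hz hz1 hε
    (hle.trans (Vfloor_antitone_beta le_rfl h1 (by linarith) hz1 m)) (hcrit β h0 h1)

/-- Every arity, affine-floor slab form. -/
theorem capXLD_allA_of_slabA {β₀ β₁ z ε c₀ c₁ : ℝ} (m : ℕ) (hβ₀ : 3 / 2 ≤ β₀) (hβ₁ : β₁ ≤ 2)
    (hz : 9 / 10 ≤ z) (hz1 : z ≤ 1) (hε : 0 < ε)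
    (hfl : ∀ β : ℝ, β₀ ≤ β → β ≤ β₁ → c₀ + c₁ * β ≤ Vfloor 2 β z m)
    (hcrit : ∀ β : ℝ, β₀ ≤ β → β ≤ β₁ → RegionCriterion β z ε (c₀ + c₁ * β) (Real.log (4 / 3) / Real.log 2)) :
    ∀ a β : ℝ, 2 ≤ a → β₀ ≤ β → β ≤ β₁ →
      ∀ R : ℝ, 0 ≤ R → ∀ y₀ : ℝ → ℝ, (∀ b : ℝ, 0 ≤ b → 0 ≤ y₀ b ∧ y₀ b ≤ R / (b + β)) →
        ∃ C : ℝ, ∀ s : Sched, Admissible a β s →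
          dev β y₀ s ≤ C * logSize β s ^ (Real.log (4 / 3) / Real.log 2) :=
  fun _ β ha h0 h1 => capXLD_allA_of_criterion m ha (hβ₀.trans h0) (h1.trans hβ₁) hz hz1 hε (hfl β h0 h1)
    (hcrit β h0 h1)

/-! ## The certified dials, every arity -/

/-- **XL-D(a, 8/5) for every `a ≥ 2`, all admissible schedules** (model level). -/
theorem capXLD_allA_eight_fifths {a : ℝ} (ha : 2 ≤ a) :
    ∀ R : ℝ, 0 ≤ R → ∀ y₀ : ℝ → ℝ, (∀ b : ℝ, 0 ≤ b → 0 ≤ y₀ b ∧ y₀ b ≤ R / (b + 8 / 5)) →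
      ∃ C : ℝ, ∀ s : Sched, Admissible a (8 / 5) s →
        dev (8 / 5) y₀ s ≤ C * logSize (8 / 5) s ^ (Real.log (4 / 3) / Real.log 2) :=
  capXLD_allA_of_criterion 12 ha (by norm_num) (by norm_num) (by norm_num) (by norm_num) (by norm_num)
    (le_trans (by norm_num) Vfloor_eight_fifths) FarEdgeDescentCert85.regionCriterion_eight_fifths

/-- **XL-D(a, 19/10) for every `a ≥ 2`.** -/
theorem capXLD_allA_nineteen_tenths {a : ℝ} (ha : 2 ≤ a) :
    ∀ R : ℝ, 0 ≤ R → ∀ y₀ : ℝ → ℝ, (∀ b : ℝ, 0 ≤ b → 0 ≤ y₀ b ∧ y₀ b ≤ R / (b + 19 / 10)) →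
      ∃ C : ℝ, ∀ s : Sched, Admissible a (19 / 10) s →
        dev (19 / 10) y₀ s ≤ C * logSize (19 / 10) s ^ (Real.log (4 / 3) / Real.log 2) :=
  capXLD_allA_of_criterion 12 ha (by norm_num) (by norm_num) (by norm_num) (by norm_num) (by norm_num)
    (le_trans (by norm_num) Vfloor_nineteen_tenths) FarEdgeDescentCert19.regionCriterion_nineteen_tenths

/-- **XL-D(a, 39/20) for every `a ≥ 2`.** -/
theorem capXLD_allA_39_20 {a : ℝ} (ha : 2 ≤ a) :
    ∀ R : ℝ, 0 ≤ R → ∀ y₀ : ℝ → ℝ, (∀ b : ℝ, 0 ≤ b → 0 ≤ y₀ b ∧ y₀ b ≤ R / (b + 39 / 20)) →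
      ∃ C : ℝ, ∀ s : Sched, Admissible a (39 / 20) s →
        dev (39 / 20) y₀ s ≤ C * logSize (39 / 20) s ^ (Real.log (4 / 3) / Real.log 2) :=
  capXLD_allA_of_criterion 12 ha (by norm_num) (by norm_num) (by norm_num) (by norm_num) (by norm_num)
    (le_trans (by norm_num) FarEdgeDescentCriterionDials.Vfloor_39_20) FarEdgeDescentCert3920.regionCriterion_39_20

/-- **XL-D(a, 199/100) for every `a ≥ 2`.** -/
theorem capXLD_allA_199_100 {a : ℝ} (ha : 2 ≤ a) :
    ∀ R : ℝ, 0 ≤ R → ∀ y₀ : ℝ → ℝ, (∀ b : ℝ, 0 ≤ b → 0 ≤ y₀ b ∧ y₀ b ≤ R / (b + 199 / 100)) →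
      ∃ C : ℝ, ∀ s : Sched, Admissible a (199 / 100) s →
        dev (199 / 100) y₀ s ≤ C * logSize (199 / 100) s ^ (Real.log (4 / 3) / Real.log 2) :=
  capXLD_allA_of_criterion 12 ha (by norm_num) (by norm_num) (by norm_num) (by norm_num) (by norm_num)
    (le_trans (by norm_num) FarEdgeDescentCriterionDials.Vfloor_199_100) FarEdgeDescentCert199.regionCriterion_199_100

end Summit.MatrixMultiplication.MatrixMultiplication.Theorems.FarEdgeDescentAllArities
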